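/-
Copyright: cell pub-balaban-gaps (YM BLITZ Y1, track G1), seat g1-p2 GEN 12 (unit `pub-balaban-gaps-g1-p2`).  Row (D4) NODE O,
MECHANISM level — ROAD (c′) of g1-plan-1 GEN 39 ([G1-PLAN1-G39-PRECISION-110], skeleton #26 (K)): the COMMUTATOR `[h ⊗ 1, Δ_W]` of a
site multiplier with 59b's covariant Laplacian in print's (3.88) shape — FIRST ORDER in the difference family `covDop` with coefficients
`(1 + W^±_μ)·(∇^{η,±}_μh ⊗ 1)` placed LEFT of the differences (so that 66's derivative letters of a local inverse apply without a further
commutator), plus a ZEROTH-ORDER site-diagonal remainder `Δ^η_μh ⊗ 1 + η⁻¹(W⁺_μ·∇⁺_μh − W⁻_μ·∇⁻_μh) ⊗ 1` whose fibre row masses are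
`≤ |Δ^ηh|_∞ + (β⁺ + β⁻)|∇^ηh|_∞` when the defect windows are `Σ_b‖W^±(x)_{ab}‖ ≤ ηβ^±` — the `η⁻¹` is ABSORBED, no letter depends on `K`.
HONEST FRAMING: [folklore] matrix algebra over 59b's definitions; `h`, `W^±` are data; nothing of Bałaban's `Δ^{(k)}(𝐔)` is constructed;
words of row (D4) UNCHANGED (`ExistsUniformAcrossSmall` + `TermDomination`, OBJECT level); (D4) instance 0∕1; NOT BetaPertH, NOT continuum, NOT Clay.
-/
import Summits.QuantumFields.BalabanUV.Gaps.D4WalkBlockSeedResummation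

/-!
# `Gaps.D4WalkBlockCommutator388` — (3.88): `[h ⊗ 1, Δ_W]` is first order in `covDop` with `O(∇h)` coefficients and a K-free
# zeroth-order remainder (cell pub-balaban-gaps, seat g1-p2 gen 12)

HONEST DEPENDENCY (cell pub-balaban, verbatim): continuum YM on T⁴ ⇐ BetaPertH ∧ nine spine estimates (0/9 proved);
BetaPertH ⇐ (D1) ∧ (D4) ∧ CAP+tail.

[B9] (3.88) p. 409: «(Δ′_a hλ)(x) = h(x)(Δ′_aλ)(x) − Σ_{b∋x}(∂h)(b)(D_Uλ)(b) + (Δh)(x)λ(x)»; (3.89): the step `K(h_□)G′_□h_□` is `O(M⁻¹)`.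
For 59b's `Δ_W = η⁻²Σ_μ(2 − (1 + W⁺_μ)S_μ − (1 + W⁻_μ)S⁻_μ)` ((3.50) at background `1` with defects) and a real site function `h`, with
`∇⁺_μh(y) = η⁻¹(h(y + e_μ) − h(y))`, `∇⁻_μh(y) = η⁻¹(h(y) − h(y − e_μ))`, `Δ^η_μh(y) = η⁻²(h(y + e_μ) − 2h(y) + h(y − e_μ))` (all inlined):
* §1 exchange of the weight with the shifts: `wOp_mul_Sf` ∕ `wOp_mul_SBf` ∕ `Sf_mul_wOp` ∕ `SBf_mul_wOp`, `wOp_comm_one_add_fibDiag`,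
  `comm_coeff_Sf` ∕ `comm_coeff_SBf`.
* §2 **`commutator_covLap`** (K₁, shift form): `[h⊗1, Δ_W] = η⁻¹Σ_μ((1 + D⁺_μ)S_μ(∇⁻_μh ⊗ 1) − (1 + D⁻_μ)S⁻_μ(∇⁺_μh ⊗ 1))`;
  **`commutator_covLap_left`** (K₁′): `= η⁻¹Σ_μ((1 + D⁺_μ)(∇⁺_μh ⊗ 1)S_μ − (1 + D⁻_μ)(∇⁻_μh ⊗ 1)S⁻_μ)`;
  **`commutator_covLap_firstOrder`** (K₂): `= Σ_μ((1 + D⁺_μ)(∇⁺_μh⊗1)·covDop(inl μ) + (1 + D⁻_μ)(∇⁻_μh⊗1)·covDop(inr μ)) + Σ_μ Z_μ`,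
  `Z_μ = Δ^η_μh ⊗ 1 + η⁻¹(D⁺_μ(∇⁺_μh⊗1) − D⁻_μ(∇⁻_μh⊗1))` (`S_μ = 1 + η∂_μ`, `S⁻_μ = 1 − ηS⁻_μ∂_μ`, 59b `Sf_eq` ∕ `SBf_eq`).
* §3 the letters: `coeff_eq_fibDiag` ∕ `rowSum_coeff_le` (`(1 + D)(w ⊗ 1)` has fibre row masses `≤ |w|_∞(1 + ηβ)`), `zeroth_eq_fibDiag` ∕
  **`rowSum_zeroth_le`** (`≤ |Δ^ηh|_∞ + β⁺|∇⁺h|_∞ + β⁻|∇⁻h|_∞` — the `η⁻¹` absorbed by the windows), `blockNorm_zeroth_le`;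
  `rowSum_commutator_le_of_osc` (`[h⊗1, M]` for a kernel living where `|h(x) − h(x′)| ≤ ω`: row masses `≤ ω·` those of `M` — the
  averaging term `a_K[h⊗1, P_K(U)]`, `ω = osc_{unit block}h`).
WHAT IT IS NOT.  The assembly of the STEP terms `(H_□A_□ − A_□H_□)G_□H_□` with 66's value ∕ derivative letters into 56's data is the next
file; OBJECT level untouched.

References (method only): T. Bałaban, Comm. Math. Phys. **99** (1985) 389–434 [B9], (3.50) p. 400, (3.88)–(3.89) p. 409.
-/

noncomputable section

namespace Summit.QuantumFields.BalabanUV.Gaps.D4WalkBlockCommutator388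

open Finset Complex Matrix
open scoped BigOperators Matrix
open Literature.MathematicalPhysics.QuantumFieldTheory.Balaban1983to89
open Literature.MathematicalPhysics.QuantumFieldTheory.Balaban1983to89.B5TorusCover (UT)
open Summit.QuantumFields.BalabanUV.Gaps.D4WalkBlock (blockNorm)
open Summit.QuantumFields.BalabanUV.Gaps.D4WalkBlockShiftAlgebra (fibD)
open Summit.QuantumFields.BalabanUV.Gaps.D4WalkBlockShiftWeighted (wOp wOp_mul_apply wOp_mul_fibD fibD_mul_wOp)
open Summit.QuantumFields.BalabanUV.Gaps.D4WalkBlockShiftWeightedAv (mul_wOp_apply)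
open Summit.QuantumFields.BalabanUV.Gaps.D4WalkBlockCovariantDerivative (wOp_mul_fibD_comm)
open Summit.QuantumFields.BalabanUV.Gaps.D4WalkBlockCovariantGeometry (fibDiag SBf shift_unshift blockNorm_fibDiag_le)
open Summit.QuantumFields.BalabanUV.Gaps.D4WalkBlockCovariantShift (Sf Df covDop covLap Sf_eq SBf_eq)
open Summit.QuantumFields.BalabanUV.Gaps.D4WalkBlockCovariantPropagator (unshift_shift)
open Summit.QuantumFields.BalabanUV.Gaps.D4WalkBlockFormGaugeTorus (fibDiag_eq_fibD)
open Summit.QuantumFields.BalabanUV.Gaps.D4WalkBlockSeedResummation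
  (wOp_sub wOp_smul wOp_add wOp_commutator_apply wOp_commutator_smul_one)

variable (P : Params) (F : Type) [Fintype F] [DecidableEq F]
variable {E : Type*}

/-! ## §1. Exchange of the weight with the shifts -/

section Exchange

/-- `(h ⊗ 1)·S_μ = S_μ·(h(· − e_μ) ⊗ 1)`. ([folklore]) -/
theorem wOp_mul_Sf (h : Site P 0 → ℝ) (μ : Fin P.d) :
    wOp (Site P 0) F h * Sf P F μ = Sf P F μ * wOp (Site P 0) F (fun y => h (Site.unshift y μ)) := by
  ext p q
  rw [wOp_mul_apply, mul_wOp_apply]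
  simp only [Sf, Matrix.of_apply]
  by_cases hq : q = (Site.shift p.1 μ, p.2)
  · subst hq; simp [unshift_shift]
  · rw [if_neg hq, mul_zero, zero_mul]

/-- `(h ⊗ 1)·S⁻_μ = S⁻_μ·(h(· + e_μ) ⊗ 1)`. ([folklore]) -/
theorem wOp_mul_SBf (h : Site P 0 → ℝ) (μ : Fin P.d) :
    wOp (Site P 0) F h * SBf P F μ = SBf P F μ * wOp (Site P 0) F (fun y => h (Site.shift y μ)) := by
  ext p q
  rw [wOp_mul_apply, mul_wOp_apply]
  simp only [SBf, Matrix.of_apply]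
  by_cases hq : q = (Site.unshift p.1 μ, p.2)
  · subst hq; simp [shift_unshift]
  · rw [if_neg hq, mul_zero, zero_mul]

/-- `S_μ·(w ⊗ 1) = (w(· + e_μ) ⊗ 1)·S_μ`. ([folklore]) -/
theorem Sf_mul_wOp (w : Site P 0 → ℝ) (μ : Fin P.d) :
    Sf P F μ * wOp (Site P 0) F w = wOp (Site P 0) F (fun y => w (Site.shift y μ)) * Sf P F μ := by
  rw [wOp_mul_Sf]; simp only [shift_unshift]

/-- `S⁻_μ·(w ⊗ 1) = (w(· − e_μ) ⊗ 1)·S⁻_μ`. ([folklore]) -/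
theorem SBf_mul_wOp (w : Site P 0 → ℝ) (μ : Fin P.d) :
    SBf P F μ * wOp (Site P 0) F w = wOp (Site P 0) F (fun y => w (Site.unshift y μ)) * SBf P F μ := by
  rw [wOp_mul_SBf]; simp only [unshift_shift]

/-- the weight commutes with `1 + fibDiag W`. ([folklore]) -/
theorem wOp_comm_one_add_fibDiag (h : Site P 0 → ℝ) (W : Site P 0 → Matrix F F ℂ) :
    wOp (Site P 0) F h * (1 + fibDiag P F W) = (1 + fibDiag P F W) * wOp (Site P 0) F h := by
  rw [Matrix.mul_add, Matrix.add_mul, Matrix.mul_one, Matrix.one_mul, fibDiag_eq_fibD, wOp_mul_fibD_comm]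

/-- `[h⊗1, (1 + D)S_μ] = (1 + D)·S_μ·((h(· − e_μ) − h) ⊗ 1)`. ([folklore]) -/
theorem comm_coeff_Sf (h : Site P 0 → ℝ) (W : Site P 0 → Matrix F F ℂ) (μ : Fin P.d) :
    wOp (Site P 0) F h * ((1 + fibDiag P F W) * Sf P F μ) - (1 + fibDiag P F W) * Sf P F μ * wOp (Site P 0) F h
      = (1 + fibDiag P F W) * (Sf P F μ * wOp (Site P 0) F (fun y => h (Site.unshift y μ) - h y)) := by
  rw [← Matrix.mul_assoc, wOp_comm_one_add_fibDiag, Matrix.mul_assoc _ (wOp (Site P 0) F h), wOp_mul_Sf,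
    Matrix.mul_assoc _ (Sf P F μ), ← Matrix.mul_sub, ← Matrix.mul_sub, ← wOp_sub]

/-- `[h⊗1, (1 + D)S⁻_μ] = (1 + D)·S⁻_μ·((h(· + e_μ) − h) ⊗ 1)`. ([folklore]) -/
theorem comm_coeff_SBf (h : Site P 0 → ℝ) (W : Site P 0 → Matrix F F ℂ) (μ : Fin P.d) :
    wOp (Site P 0) F h * ((1 + fibDiag P F W) * SBf P F μ) - (1 + fibDiag P F W) * SBf P F μ * wOp (Site P 0) F h
      = (1 + fibDiag P F W) * (SBf P F μ * wOp (Site P 0) F (fun y => h (Site.shift y μ) - h y)) := by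
  rw [← Matrix.mul_assoc, wOp_comm_one_add_fibDiag, Matrix.mul_assoc _ (wOp (Site P 0) F h), wOp_mul_SBf,
    Matrix.mul_assoc _ (SBf P F μ), ← Matrix.mul_sub, ← Matrix.mul_sub, ← wOp_sub]

end Exchange

/-! ## §2. (3.88): the commutator with the covariant Laplacian -/

section Commutator
variable (Wp Wm : Fin P.d → E → Site P 0 → Matrix F F ℂ)

/-- the summand-level commutator behind (K₁). ([folklore]) -/
theorem commutator_summand (u : E) (h : Site P 0 → ℝ) (μ : Fin P.d) :
    wOp (Site P 0) F h * ((2 : ℂ) • (1 : Matrix (Site P 0 × F) (Site P 0 × F) ℂ) -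
        (1 + fibDiag P F (Wp μ u)) * Sf P F μ - (1 + fibDiag P F (Wm μ u)) * SBf P F μ) -
      ((2 : ℂ) • (1 : Matrix (Site P 0 × F) (Site P 0 × F) ℂ) -
        (1 + fibDiag P F (Wp μ u)) * Sf P F μ - (1 + fibDiag P F (Wm μ u)) * SBf P F μ) * wOp (Site P 0) F h
      = (P.eps : ℂ) • ((1 + fibDiag P F (Wp μ u)) * (Sf P F μ *
            wOp (Site P 0) F (fun y => P.eps⁻¹ * (h y - h (Site.unshift y μ))))
          - (1 + fibDiag P F (Wm μ u)) * (SBf P F μ *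
            wOp (Site P 0) F (fun y => P.eps⁻¹ * (h (Site.shift y μ) - h y)))) := by
  have hε : P.eps ≠ 0 := P.eps_pos.ne'
  have e : wOp (Site P 0) F h * ((2 : ℂ) • (1 : Matrix (Site P 0 × F) (Site P 0 × F) ℂ) -
        (1 + fibDiag P F (Wp μ u)) * Sf P F μ - (1 + fibDiag P F (Wm μ u)) * SBf P F μ) -
        ((2 : ℂ) • (1 : Matrix (Site P 0 × F) (Site P 0 × F) ℂ) -
        (1 + fibDiag P F (Wp μ u)) * Sf P F μ - (1 + fibDiag P F (Wm μ u)) * SBf P F μ) * wOp (Site P 0) F h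
      = (wOp (Site P 0) F h * ((2 : ℂ) • (1 : Matrix (Site P 0 × F) (Site P 0 × F) ℂ)) -
          (2 : ℂ) • (1 : Matrix (Site P 0 × F) (Site P 0 × F) ℂ) * wOp (Site P 0) F h)
        - (wOp (Site P 0) F h * ((1 + fibDiag P F (Wp μ u)) * Sf P F μ) -
            (1 + fibDiag P F (Wp μ u)) * Sf P F μ * wOp (Site P 0) F h)
        - (wOp (Site P 0) F h * ((1 + fibDiag P F (Wm μ u)) * SBf P F μ) -
            (1 + fibDiag P F (Wm μ u)) * SBf P F μ * wOp (Site P 0) F h) := by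
    simp only [Matrix.mul_sub, Matrix.sub_mul]; abel
  have g1 : wOp (Site P 0) F (fun y => h (Site.unshift y μ) - h y)
      = (-(P.eps : ℂ)) • wOp (Site P 0) F (fun y => P.eps⁻¹ * (h y - h (Site.unshift y μ))) := by
    rw [show (-(P.eps : ℂ)) = ((-P.eps : ℝ) : ℂ) by push_cast; ring, ← wOp_smul]
    congr 1; funext y; field_simp; ring
  have g2 : wOp (Site P 0) F (fun y => h (Site.shift y μ) - h y)
      = (P.eps : ℂ) • wOp (Site P 0) F (fun y => P.eps⁻¹ * (h (Site.shift y μ) - h y)) := by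
    rw [← wOp_smul]
    congr 1; funext y; field_simp
  rw [e, wOp_commutator_smul_one, zero_sub, comm_coeff_Sf, comm_coeff_SBf, g1, g2]
  simp only [Matrix.mul_smul, Matrix.mul_neg, neg_smul, neg_neg, smul_sub]

/-- **(K₁) `[h ⊗ 1, Δ_W]` IN SHIFT FORM**:
`(h⊗1)Δ_W − Δ_W(h⊗1) = η⁻¹Σ_μ((1 + D⁺_μ)·S_μ·(∇⁻_μh ⊗ 1) − (1 + D⁻_μ)·S⁻_μ·(∇⁺_μh ⊗ 1))`, `∇⁻_μh(y) = η⁻¹(h(y) − h(y − e_μ))`,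
`∇⁺_μh(y) = η⁻¹(h(y + e_μ) − h(y))` (from `(h⊗1)S_μ = S_μ(h(·−e_μ)⊗1)`, `[h⊗1, D^±] = 0`, `[h⊗1, 1] = 0`).
[cite: Balaban1985BackgroundPropagators, (3.88) p.409, (3.50) p.400] -/
theorem commutator_covLap (u : E) (h : Site P 0 → ℝ) :
    wOp (Site P 0) F h * covLap P F Wp Wm u - covLap P F Wp Wm u * wOp (Site P 0) F h
      = (P.eps⁻¹ : ℂ) • ∑ μ, ((1 + fibDiag P F (Wp μ u)) * (Sf P F μ *
            wOp (Site P 0) F (fun y => P.eps⁻¹ * (h y - h (Site.unshift y μ))))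
          - (1 + fibDiag P F (Wm μ u)) * (SBf P F μ *
            wOp (Site P 0) F (fun y => P.eps⁻¹ * (h (Site.shift y μ) - h y)))) := by
  have hε : (P.eps : ℂ) ≠ 0 := by exact_mod_cast P.eps_pos.ne'
  have hS : wOp (Site P 0) F h * (∑ μ, ((2 : ℂ) • (1 : Matrix (Site P 0 × F) (Site P 0 × F) ℂ) -
        (1 + fibDiag P F (Wp μ u)) * Sf P F μ - (1 + fibDiag P F (Wm μ u)) * SBf P F μ)) -
      (∑ μ, ((2 : ℂ) • (1 : Matrix (Site P 0 × F) (Site P 0 × F) ℂ) -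
        (1 + fibDiag P F (Wp μ u)) * Sf P F μ - (1 + fibDiag P F (Wm μ u)) * SBf P F μ)) * wOp (Site P 0) F h
      = (P.eps : ℂ) • ∑ μ, ((1 + fibDiag P F (Wp μ u)) * (Sf P F μ *
            wOp (Site P 0) F (fun y => P.eps⁻¹ * (h y - h (Site.unshift y μ))))
          - (1 + fibDiag P F (Wm μ u)) * (SBf P F μ *
            wOp (Site P 0) F (fun y => P.eps⁻¹ * (h (Site.shift y μ) - h y)))) := by
    rw [Finset.mul_sum, Finset.sum_mul, ← Finset.sum_sub_distrib, Finset.smul_sum]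
    exact Finset.sum_congr rfl fun μ _ => commutator_summand P F Wp Wm u h μ
  unfold covLap
  rw [Matrix.mul_smul, Matrix.smul_mul, ← smul_sub, hS, smul_smul, pow_two, mul_assoc, inv_mul_cancel₀ hε, mul_one]

/-- **(K₁′) `[h ⊗ 1, Δ_W]` WITH THE WEIGHTS LEFT OF THE SHIFTS**:
`= η⁻¹Σ_μ((1 + D⁺_μ)·(∇⁺_μh ⊗ 1)·S_μ − (1 + D⁻_μ)·(∇⁻_μh ⊗ 1)·S⁻_μ)` (`S_μ(w⊗1) = (w(·+e_μ)⊗1)S_μ` turns `∇⁻h` into `∇⁺h` and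
vice versa). [cite: Balaban1985BackgroundPropagators, (3.88) p.409] -/
theorem commutator_covLap_left (u : E) (h : Site P 0 → ℝ) :
    wOp (Site P 0) F h * covLap P F Wp Wm u - covLap P F Wp Wm u * wOp (Site P 0) F h
      = (P.eps⁻¹ : ℂ) • ∑ μ, ((1 + fibDiag P F (Wp μ u)) *
            (wOp (Site P 0) F (fun y => P.eps⁻¹ * (h (Site.shift y μ) - h y)) * Sf P F μ)
          - (1 + fibDiag P F (Wm μ u)) *
            (wOp (Site P 0) F (fun y => P.eps⁻¹ * (h y - h (Site.unshift y μ))) * SBf P F μ)) := by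
  rw [commutator_covLap]
  refine congrArg _ (Finset.sum_congr rfl fun μ _ => ?_)
  rw [Sf_mul_wOp, SBf_mul_wOp]
  simp only [unshift_shift, shift_unshift]

/-- `covDop (inl μ) = ∂_μ ⊗ 1` (59b's definition). -/
theorem covDop_inl_eq (μ : Fin P.d) : covDop P F (Sum.inl μ) = Df P F μ := rfl

/-- `covDop (inr μ) = S⁻_μ(∂_μ ⊗ 1)` (59b's definition). -/
theorem covDop_inr_eq (μ : Fin P.d) : covDop P F (Sum.inr μ) = SBf P F μ * Df P F μ := rfl

/-- the per-axis algebra of (K₂): `S_μ = 1 + η∂_μ`, `S⁻_μ = 1 − ηS⁻_μ∂_μ` substituted into (K₁′)'s summand. ([folklore]) -/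
theorem firstOrder_summand (W W' : Site P 0 → Matrix F F ℂ) (h : Site P 0 → ℝ) (μ : Fin P.d) :
    (P.eps⁻¹ : ℂ) • ((1 + fibDiag P F W) *
          (wOp (Site P 0) F (fun y => P.eps⁻¹ * (h (Site.shift y μ) - h y)) * Sf P F μ)
        - (1 + fibDiag P F W') *
          (wOp (Site P 0) F (fun y => P.eps⁻¹ * (h y - h (Site.unshift y μ))) * SBf P F μ))
      = ((1 + fibDiag P F W) *
            (wOp (Site P 0) F (fun y => P.eps⁻¹ * (h (Site.shift y μ) - h y)) * covDop P F (Sum.inl μ))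
          + (1 + fibDiag P F W') *
            (wOp (Site P 0) F (fun y => P.eps⁻¹ * (h y - h (Site.unshift y μ))) * covDop P F (Sum.inr μ)))
        + (wOp (Site P 0) F (fun y => (P.eps⁻¹) ^ 2 * (h (Site.shift y μ) - 2 * h y + h (Site.unshift y μ)))
          + (P.eps⁻¹ : ℂ) • (fibDiag P F W * wOp (Site P 0) F (fun y => P.eps⁻¹ * (h (Site.shift y μ) - h y))
              - fibDiag P F W' * wOp (Site P 0) F (fun y => P.eps⁻¹ * (h y - h (Site.unshift y μ))))) := by
  have hε : P.eps ≠ 0 := P.eps_pos.ne'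
  have hε' : (P.eps : ℂ) ≠ 0 := by exact_mod_cast hε
  rw [covDop_inl_eq, covDop_inr_eq]
  set Qp := wOp (Site P 0) F (fun y => P.eps⁻¹ * (h (Site.shift y μ) - h y)) with hQp
  set Qm := wOp (Site P 0) F (fun y => P.eps⁻¹ * (h y - h (Site.unshift y μ))) with hQm
  set A := (1 + fibDiag P F W) with hA
  set B := (1 + fibDiag P F W') with hB
  have hD : fibDiag P F W * Qp = A * Qp - Qp := by rw [hA, Matrix.add_mul, Matrix.one_mul, add_sub_cancel_left]
  have hD' : fibDiag P F W' * Qm = B * Qm - Qm := by rw [hB, Matrix.add_mul, Matrix.one_mul, add_sub_cancel_left]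
  have e1 : Qp * Sf P F μ = Qp + (P.eps : ℂ) • (Qp * Df P F μ) := by
    rw [Sf_eq (P := P) (F := F) μ, Matrix.mul_add, Matrix.mul_one, Matrix.mul_smul]
  have e2 : Qm * SBf P F μ = Qm - (P.eps : ℂ) • (Qm * (SBf P F μ * Df P F μ)) := by
    conv_lhs => rw [SBf_eq (P := P) (F := F) μ]
    rw [Matrix.mul_sub, Matrix.mul_one, Matrix.mul_smul]
  have e3 : wOp (Site P 0) F (fun y => (P.eps⁻¹) ^ 2 * (h (Site.shift y μ) - 2 * h y + h (Site.unshift y μ)))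
      = (P.eps⁻¹ : ℂ) • (Qp - Qm) := by
    rw [hQp, hQm, ← wOp_sub, ← Complex.ofReal_inv, ← wOp_smul]; congr 1; funext y; field_simp; ring
  have key : ∀ X : Matrix (Site P 0 × F) (Site P 0 × F) ℂ, (P.eps : ℂ)⁻¹ • ((P.eps : ℂ) • X) = X := fun X => by
    rw [smul_smul, inv_mul_cancel₀ hε', one_smul]
  rw [hD, hD', e1, e2, e3, Matrix.mul_add, Matrix.mul_sub, Matrix.mul_smul, Matrix.mul_smul]
  simp only [smul_sub, smul_add, key]
  abel

/-- **(K₂) `[h ⊗ 1, Δ_W]` IS FIRST ORDER IN `covDop` WITH `O(∇h)` COEFFICIENTS PLUS A ZEROTH-ORDER SITE-DIAGONAL REMAINDER**: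
`(h⊗1)Δ_W − Δ_W(h⊗1) = Σ_μ((1 + D⁺_μ)(∇⁺_μh ⊗ 1)·covDop(inl μ) + (1 + D⁻_μ)(∇⁻_μh ⊗ 1)·covDop(inr μ)) + Σ_μ Z_μ`,
`Z_μ = Δ^η_μh ⊗ 1 + η⁻¹(D⁺_μ(∇⁺_μh ⊗ 1) − D⁻_μ(∇⁻_μh ⊗ 1))` — print's `−Σ_b(∂h)(b)D_U + (Δh)` with the defect corrections displayed.
[cite: Balaban1985BackgroundPropagators, (3.88)–(3.89) p.409] -/
theorem commutator_covLap_firstOrder (u : E) (h : Site P 0 → ℝ) :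
    wOp (Site P 0) F h * covLap P F Wp Wm u - covLap P F Wp Wm u * wOp (Site P 0) F h
      = ∑ μ, ((1 + fibDiag P F (Wp μ u)) *
            (wOp (Site P 0) F (fun y => P.eps⁻¹ * (h (Site.shift y μ) - h y)) * covDop P F (Sum.inl μ))
          + (1 + fibDiag P F (Wm μ u)) *
            (wOp (Site P 0) F (fun y => P.eps⁻¹ * (h y - h (Site.unshift y μ))) * covDop P F (Sum.inr μ)))
        + ∑ μ, (wOp (Site P 0) F (fun y => (P.eps⁻¹) ^ 2 * (h (Site.shift y μ) - 2 * h y + h (Site.unshift y μ)))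
          + (P.eps⁻¹ : ℂ) • (fibDiag P F (Wp μ u) * wOp (Site P 0) F (fun y => P.eps⁻¹ * (h (Site.shift y μ) - h y))
              - fibDiag P F (Wm μ u) * wOp (Site P 0) F (fun y => P.eps⁻¹ * (h y - h (Site.unshift y μ))))) := by
  rw [commutator_covLap_left, Finset.smul_sum, ← Finset.sum_add_distrib]
  exact Finset.sum_congr rfl fun μ _ => firstOrder_summand P F (Wp μ u) (Wm μ u) h μ

end Commutator

/-! ## §3. The letters: coefficients `O(∇h)`, remainder `O(Δh) + O(β∇h)` with the `η⁻¹` absorbed -/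

section Letters

omit [Fintype F] [DecidableEq F] in
/-- `fibD` is subtractive. ([folklore]) -/
theorem fibD_sub (w w' : Site P 0 → Matrix F F ℂ) :
    fibD (Site P 0) F (fun x => w x - w' x) = fibD (Site P 0) F w - fibD (Site P 0) F w' := by
  ext p q; simp only [fibD, Matrix.of_apply, Matrix.sub_apply]; split_ifs <;> simp

omit [DecidableEq F] in
/-- fibre row masses of a site-diagonal operator. ([folklore]) -/
theorem rowSum_fibD_apply (g : Site P 0 → Matrix F F ℂ) (p : Site P 0 × F) :
    ∑ q, ‖fibD (Site P 0) F g p q‖ = ∑ b, ‖g p.1 p.2 b‖ :=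
  D4WalkBlockGaugeAlgebra.rowSum_fibD g p

/-- **THE FIRST-ORDER COEFFICIENT IS SITE-DIAGONAL**: `(1 + D)(w ⊗ 1) = fibD(x ↦ w(x)·(1 + W(x)))`. ([folklore]) -/
theorem coeff_eq_fibDiag (W : Site P 0 → Matrix F F ℂ) (w : Site P 0 → ℝ) :
    (1 + fibDiag P F W) * wOp (Site P 0) F w = fibD (Site P 0) F (fun x => ((w x : ℝ) : ℂ) • (1 + W x)) := by
  rw [Matrix.add_mul, Matrix.one_mul, fibDiag_eq_fibD, fibD_mul_wOp]
  unfold wOp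
  rw [← D4WalkBlockShiftAlgebra.fibD_add]
  congr 1; funext x; rw [smul_add]

/-- fibre row masses of the identity. ([folklore]) -/
theorem rowSum_one_fibre (a : F) : ∑ b, ‖(1 : Matrix F F ℂ) a b‖ = 1 := by
  rw [Finset.sum_eq_single a]
  · rw [Matrix.one_apply_eq, norm_one]
  · intro b _ hb; rw [Matrix.one_apply_ne' hb, norm_zero]
  · intro h; exact absurd (Finset.mem_univ a) h

/-- **LETTER OF THE FIRST-ORDER COEFFICIENT**: `|w| ≤ δ`, `Σ_b‖W(x)_{ab}‖ ≤ ηβ` ⟹ row masses of `(1 + D)(w ⊗ 1)` at most `δ(1 + ηβ)`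
(`≤ 2δ` once `ηβ ≤ 1`: print's `O(M⁻¹)` for `w = ∇h_□`). [cite: Balaban1985BackgroundPropagators, (3.89) p.409] -/
theorem rowSum_coeff_le (W : Site P 0 → Matrix F F ℂ) (w : Site P 0 → ℝ) {δ β : ℝ} (hw : ∀ x, |w x| ≤ δ) (hW : ∀ x a, ∑ b, ‖W x a b‖ ≤ P.eps * β) (p : Site P 0 × F) :
    ∑ q, ‖((1 + fibDiag P F W) * wOp (Site P 0) F w) p q‖ ≤ δ * (1 + P.eps * β) := by
  rw [coeff_eq_fibDiag, rowSum_fibD_apply]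
  calc ∑ b, ‖((((w p.1 : ℝ) : ℂ)) • (1 + W p.1)) p.2 b‖
      = |w p.1| * ∑ b, ‖(1 + W p.1) p.2 b‖ := by
        rw [Finset.mul_sum]
        exact Finset.sum_congr rfl fun b _ => by
          rw [Matrix.smul_apply, smul_eq_mul, norm_mul, Complex.norm_real, Real.norm_eq_abs]
    _ ≤ |w p.1| * (1 + P.eps * β) := by
        refine mul_le_mul_of_nonneg_left ?_ (abs_nonneg _)
        calc ∑ b, ‖(1 + W p.1) p.2 b‖ ≤ ∑ b, (‖(1 : Matrix F F ℂ) p.2 b‖ + ‖W p.1 p.2 b‖) :=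
              Finset.sum_le_sum fun b _ => by rw [Matrix.add_apply]; exact norm_add_le _ _
          _ = 1 + ∑ b, ‖W p.1 p.2 b‖ := by rw [Finset.sum_add_distrib, rowSum_one_fibre]
          _ ≤ 1 + P.eps * β := by linarith [hW p.1 p.2]
    _ ≤ δ * (1 + P.eps * β) := by
        have : 0 ≤ 1 + P.eps * β := by
          have h0 : 0 ≤ P.eps * β := le_trans (Finset.sum_nonneg fun b _ => norm_nonneg _) (hW p.1 p.2)
          linarith
        exact mul_le_mul_of_nonneg_right (hw p.1) this

/-- **THE ZEROTH-ORDER REMAINDER IS SITE-DIAGONAL**: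
`Δ^ηh ⊗ 1 + η⁻¹(D⁺(w⁺ ⊗ 1) − D⁻(w⁻ ⊗ 1)) = fibD(x ↦ Δ^ηh(x)·1 + η⁻¹w⁺(x)·W⁺(x) − η⁻¹w⁻(x)·W⁻(x))`. ([folklore]) -/
theorem zeroth_eq_fibDiag (W W' : Site P 0 → Matrix F F ℂ) (l wp wm : Site P 0 → ℝ) :
    wOp (Site P 0) F l + (P.eps⁻¹ : ℂ) • (fibDiag P F W * wOp (Site P 0) F wp - fibDiag P F W' * wOp (Site P 0) F wm)
      = fibD (Site P 0) F (fun x => ((l x : ℝ) : ℂ) • (1 : Matrix F F ℂ) +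
          (((P.eps⁻¹ * wp x : ℝ) : ℂ) • W x - ((P.eps⁻¹ * wm x : ℝ) : ℂ) • W' x)) := by
  rw [fibDiag_eq_fibD, fibDiag_eq_fibD, fibD_mul_wOp, fibD_mul_wOp, ← fibD_sub, ← D4WalkBlockShiftAlgebra.fibD_smul]
  unfold wOp
  rw [← D4WalkBlockShiftAlgebra.fibD_add]
  congr 1; funext x
  rw [smul_sub, smul_smul, smul_smul, Complex.ofReal_mul, Complex.ofReal_mul, Complex.ofReal_inv]

/-- **LETTER OF THE ZEROTH-ORDER REMAINDER — THE `η⁻¹` IS ABSORBED BY THE WINDOWS**: `|Δ^ηh| ≤ Λ`, `|w⁺| ≤ δ⁺`, `|w⁻| ≤ δ⁻`,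
`Σ_b‖W⁺(x)_{ab}‖ ≤ ηβ⁺`, `Σ_b‖W⁻(x)_{ab}‖ ≤ ηβ⁻` ⟹ row masses `≤ Λ + δ⁺β⁺ + δ⁻β⁻` — NO `η⁻¹`, NO `K` (66 `bond_letters`: `β^± =
2letterB a₀ + letterB a₀²`). [cite: Balaban1985BackgroundPropagators, (3.88)–(3.89) p.409, (3.37) p.396] -/
theorem rowSum_zeroth_le (W W' : Site P 0 → Matrix F F ℂ) (l wp wm : Site P 0 → ℝ) {Λ δp δm βp βm : ℝ}
    (hδp : 0 ≤ δp) (hδm : 0 ≤ δm) (hl : ∀ x, |l x| ≤ Λ) (hwp : ∀ x, |wp x| ≤ δp) (hwm : ∀ x, |wm x| ≤ δm)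
    (hW : ∀ x a, ∑ b, ‖W x a b‖ ≤ P.eps * βp) (hW' : ∀ x a, ∑ b, ‖W' x a b‖ ≤ P.eps * βm) (p : Site P 0 × F) :
    ∑ q, ‖(wOp (Site P 0) F l + (P.eps⁻¹ : ℂ) •
        (fibDiag P F W * wOp (Site P 0) F wp - fibDiag P F W' * wOp (Site P 0) F wm)) p q‖ ≤ Λ + δp * βp + δm * βm := by
  have hε : 0 < P.eps := P.eps_pos
  rw [zeroth_eq_fibDiag, rowSum_fibD_apply]
  have h1 : ∑ b, ‖((((l p.1 : ℝ) : ℂ)) • (1 : Matrix F F ℂ)) p.2 b‖ ≤ Λ := by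
    have : ∑ b, ‖((((l p.1 : ℝ) : ℂ)) • (1 : Matrix F F ℂ)) p.2 b‖ = |l p.1| := by
      calc ∑ b, ‖((((l p.1 : ℝ) : ℂ)) • (1 : Matrix F F ℂ)) p.2 b‖ = |l p.1| * ∑ b, ‖(1 : Matrix F F ℂ) p.2 b‖ := by
            rw [Finset.mul_sum]
            exact Finset.sum_congr rfl fun b _ => by
              rw [Matrix.smul_apply, smul_eq_mul, norm_mul, Complex.norm_real, Real.norm_eq_abs]
        _ = |l p.1| := by rw [rowSum_one_fibre, mul_one]
    rw [this]; exact hl p.1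
  have hsm : ∀ (c : ℝ) (M : Matrix F F ℂ) {δ β : ℝ}, 0 ≤ δ → |c| ≤ δ → (∑ b, ‖M p.2 b‖) ≤ P.eps * β →
      ∑ b, ‖((((P.eps⁻¹ * c : ℝ) : ℂ)) • M) p.2 b‖ ≤ δ * β := by
    intro c M δ β hδ hc hM
    have hβ : 0 ≤ β := by
      have : 0 ≤ P.eps * β := le_trans (Finset.sum_nonneg fun b _ => norm_nonneg _) hM
      nlinarith
    calc ∑ b, ‖((((P.eps⁻¹ * c : ℝ) : ℂ)) • M) p.2 b‖ = P.eps⁻¹ * |c| * ∑ b, ‖M p.2 b‖ := by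
          rw [Finset.mul_sum]
          exact Finset.sum_congr rfl fun b _ => by
            rw [Matrix.smul_apply, smul_eq_mul, norm_mul, Complex.norm_real, Real.norm_eq_abs, abs_mul,
              abs_of_pos (inv_pos.2 hε)]
      _ ≤ P.eps⁻¹ * δ * (P.eps * β) :=
          mul_le_mul (mul_le_mul_of_nonneg_left hc (inv_pos.2 hε).le) hM (Finset.sum_nonneg fun b _ => norm_nonneg _)
            (by positivity)
      _ = δ * β := by field_simp
  calc ∑ b, ‖((((l p.1 : ℝ) : ℂ)) • (1 : Matrix F F ℂ) +
          ((((P.eps⁻¹ * wp p.1 : ℝ) : ℂ)) • W p.1 - (((P.eps⁻¹ * wm p.1 : ℝ) : ℂ)) • W' p.1)) p.2 b‖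
      ≤ ∑ b, (‖((((l p.1 : ℝ) : ℂ)) • (1 : Matrix F F ℂ)) p.2 b‖ +
          (‖((((P.eps⁻¹ * wp p.1 : ℝ) : ℂ)) • W p.1) p.2 b‖ + ‖((((P.eps⁻¹ * wm p.1 : ℝ) : ℂ)) • W' p.1) p.2 b‖)) :=
        Finset.sum_le_sum fun b _ => by
          rw [Matrix.add_apply, Matrix.sub_apply]
          exact (norm_add_le _ _).trans (add_le_add le_rfl (norm_sub_le _ _))
    _ = ∑ b, ‖((((l p.1 : ℝ) : ℂ)) • (1 : Matrix F F ℂ)) p.2 b‖ +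
          (∑ b, ‖((((P.eps⁻¹ * wp p.1 : ℝ) : ℂ)) • W p.1) p.2 b‖ + ∑ b, ‖((((P.eps⁻¹ * wm p.1 : ℝ) : ℂ)) • W' p.1) p.2 b‖) := by
        rw [Finset.sum_add_distrib, Finset.sum_add_distrib]
    _ ≤ Λ + (δp * βp + δm * βm) :=
        add_le_add h1 (add_le_add (hsm _ _ hδp (hwp p.1) (hW p.1 p.2)) (hsm _ _ hδm (hwm p.1) (hW' p.1 p.2)))
    _ = Λ + δp * βp + δm * βm := by ring

/-- the block form of the remainder's letter (cube-local, diagonal blocks `≤ Λ + δ⁺β⁺ + δ⁻β⁻`), for any cube map through the site.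
[cite: Balaban1985BackgroundPropagators, (3.89) p.409] -/
theorem blockNorm_zeroth_le {ν : ℕ} {Kv : Fin ν → ℕ} (cub : Site P 0 → UT Kv) (W W' : Site P 0 → Matrix F F ℂ)
    (l wp wm : Site P 0 → ℝ) {Λ δp δm βp βm : ℝ} (hΛ : 0 ≤ Λ) (hδp : 0 ≤ δp) (hδm : 0 ≤ δm) (hβp : 0 ≤ βp) (hβm : 0 ≤ βm)
    (hl : ∀ x, |l x| ≤ Λ) (hwp : ∀ x, |wp x| ≤ δp) (hwm : ∀ x, |wm x| ≤ δm)
    (hW : ∀ x a, ∑ b, ‖W x a b‖ ≤ P.eps * βp) (hW' : ∀ x a, ∑ b, ‖W' x a b‖ ≤ P.eps * βm) (Y : UT Kv) :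
    blockNorm (fun p : Site P 0 × F => cub p.1) (fun p : Site P 0 × F => cub p.1)
      (wOp (Site P 0) F l + (P.eps⁻¹ : ℂ) •
        (fibDiag P F W * wOp (Site P 0) F wp - fibDiag P F W' * wOp (Site P 0) F wm)) Y Y ≤ Λ + δp * βp + δm * βm := by
  rw [zeroth_eq_fibDiag, ← fibDiag_eq_fibD]
  refine blockNorm_fibDiag_le cub _ (by positivity) (fun x a => ?_) Y
  have h := rowSum_zeroth_le P F W W' l wp wm hδp hδm hl hwp hwm hW hW' (x, a)
  rwa [zeroth_eq_fibDiag, rowSum_fibD_apply] at h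

/-- **THE COMMUTATOR WITH A KERNEL OF BOUNDED `h`-OSCILLATION ON ITS SUPPORT** (the averaging term: `P_K(U)` lives in the diagonal
unit blocks, where `|h(x) − h(x′)| ≤ osc_{block}h = O(M⁻¹)`): row masses of `[h⊗1, M]` are `≤ ω·` those of `M`.
[cite: Balaban1985BackgroundPropagators, (3.88)–(3.89) p.409, (3.8) p.392] -/
theorem rowSum_commutator_le_of_osc (h : Site P 0 → ℝ) (M : Matrix (Site P 0 × F) (Site P 0 × F) ℂ) {ω : ℝ}
    (hosc : ∀ p q : Site P 0 × F, M p q ≠ 0 → |h p.1 - h q.1| ≤ ω) (p : Site P 0 × F) (s : Finset (Site P 0 × F)) :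
    ∑ q ∈ s, ‖(wOp (Site P 0) F h * M - M * wOp (Site P 0) F h) p q‖ ≤ ω * ∑ q ∈ s, ‖M p q‖ := by
  rw [Finset.mul_sum]
  refine Finset.sum_le_sum fun q _ => ?_
  rw [wOp_commutator_apply, norm_mul, Complex.norm_real, Real.norm_eq_abs]
  by_cases hM : M p q = 0
  · rw [hM, norm_zero, mul_zero, mul_zero]
  · exact mul_le_mul_of_nonneg_right (hosc p q hM) (norm_nonneg _)

end Letters

end Summit.QuantumFields.BalabanUV.Gaps.D4WalkBlockCommutator388

end
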